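import Mathlib
import Literature.Analysis.FluidPDE.VectorCalculus
import Literature.Analysis.FluidPDE.GaussianVortexPlanar
import Literature.Analysis.FluidPDE.WholeSpaceIBP

/-!
# Route `FilamentSkeletonRss` · crux `CoreGluing` (stmt-NavierStokesRegularity-15401) — accretion-mode tools

Line `zero-accretion-selection`.  The rotated Leray profile system is solved modulo the `N`
"accretion modes"
`D y = exp(−s²) · ((1 − exp(−r²)) / r²) • (t × (y − X₀))`, `s = ⟪y − X₀, t⟫`,
`r² = ‖y − X₀‖² − s²`, with `t` the unit tangent of a filament at its stagnation point `X₀`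
(a Gaussian-slab Lamb–Oseen swirl about the tangent line; Lean's junk value `0/0 = 0` on the line
`r = 0`).  This file records the four elementary facts about such a mode that the reduction stub
consumes (registered tools stub `stub_accretionModeTools`):

* the junk-valued formula equals the smooth closed form `exp(−s²) · burgersPhi (r²) • (t × (y − X₀))`
  (`burgersPhi ρ = (1 − e^{−ρ})/ρ`, `= 1` at `ρ = 0`; the two sides differ only where `r² = 0`,
  where `‖t × (y − X₀)‖² = r² = 0` by Lagrange's identity);
* the mode is `C^∞` (`burgersPhi` is entire, `s`, `‖y − X₀‖²` are polynomial, `t × ·` is linear);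
* the mode is divergence free: `div (φ L) = φ div L + ⟪L, ∇φ⟫` (`divergence_smul_apply`), the
  linear swirl `L y = t × (y − X₀)` is traceless (`⟪e, t × e⟫ = 0`), and `φ` depends on `y` only
  through `s` and `‖y − X₀‖²`, whose derivatives along `t × (y − X₀)` vanish;
* `‖D y‖ ≤ 1`: `‖t × (y − X₀)‖ = r`, `exp(−s²) ≤ 1` and `(1 − e^{−ρ})/√ρ ≤ 1` for `ρ > 0`.
-/

set_option linter.dupNamespace false

noncomputable section

namespace Summit.NavierStokesRegularity.NavierStokesRegularity.Theorems

open Literature.Analysis.FluidPDE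
open scoped RealInnerProductSpace

/-! ### Cross-product identities on `ℝ³`

Private copies of `Literature.Analysis.FluidPDE.Tao2016.real_inner_fin3`, `inner_self_cross_right`,
`inner_cross_self_left`, `norm_cross_sq` (`TaoAveragedNondegeneracy.lean`, not imported to keep the
import graph of this summit file free of the Tao-2016 cascade files). -/

/-- The real inner product on `ℝ³` in coordinates. [folklore] -/
private theorem accretion_real_inner_fin3 (a b : EuclideanSpace ℝ (Fin 3)) :
    ⟪a, b⟫ = a 0 * b 0 + a 1 * b 1 + a 2 * b 2 := by
  simp [PiLp.inner_apply, Fin.sum_univ_three, mul_comm]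

/-- The three coordinates of `a × b`. [folklore] -/
private theorem accretion_cross_apply (a b : EuclideanSpace ℝ (Fin 3)) :
    cross a b 0 = a 1 * b 2 - a 2 * b 1 ∧ cross a b 1 = a 2 * b 0 - a 0 * b 2 ∧
      cross a b 2 = a 0 * b 1 - a 1 * b 0 := by
  refine ⟨?_, ?_, ?_⟩ <;> simp [cross, cross_apply]

/-- `⟪b, a × b⟫ = 0`. [folklore] -/
private theorem accretion_inner_self_cross_right (a b : EuclideanSpace ℝ (Fin 3)) :
    ⟪b, cross a b⟫ = 0 := by
  obtain ⟨h0, h1, h2⟩ := accretion_cross_apply a b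
  rw [accretion_real_inner_fin3, h0, h1, h2]; ring

/-- `⟪a × b, a⟫ = 0`. [folklore] -/
private theorem accretion_inner_cross_self_left (a b : EuclideanSpace ℝ (Fin 3)) :
    ⟪cross a b, a⟫ = 0 := by
  obtain ⟨h0, h1, h2⟩ := accretion_cross_apply a b
  rw [accretion_real_inner_fin3, h0, h1, h2]; ring

/-- Lagrange's identity `‖a × b‖² = ‖a‖² ‖b‖² − ⟪a, b⟫²`. [folklore] -/
private theorem accretion_norm_cross_sq (a b : EuclideanSpace ℝ (Fin 3)) :
    ‖cross a b‖ ^ 2 = ‖a‖ ^ 2 * ‖b‖ ^ 2 - ⟪a, b⟫ ^ 2 := by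
  obtain ⟨h0, h1, h2⟩ := accretion_cross_apply a b
  rw [← real_inner_self_eq_norm_sq, ← real_inner_self_eq_norm_sq a, ← real_inner_self_eq_norm_sq b,
    accretion_real_inner_fin3, accretion_real_inner_fin3, accretion_real_inner_fin3,
    accretion_real_inner_fin3, h0, h1, h2]
  ring

/-! ### The accretion mode about a unit tangent `t` through `X₀` -/

/-- The transverse radius squared: for a unit vector `t`, `‖t × v‖² = ‖v‖² − ⟪v, t⟫² = r²`.
[folklore] -/
theorem norm_cross_sq_eq_transverseRadiusSq {t : EuclideanSpace ℝ (Fin 3)} (ht : ‖t‖ = 1)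
    (v : EuclideanSpace ℝ (Fin 3)) : ‖cross t v‖ ^ 2 = ‖v‖ ^ 2 - ⟪v, t⟫ ^ 2 := by
  rw [accretion_norm_cross_sq, ht, real_inner_comm]; ring

/-- **(i) Closed form.** The junk-valued accretion mode (`0/0 = 0` on the tangent line `r = 0`)
equals the smooth closed form `exp(−s²) · burgersPhi (r²) • (t × (y − X₀))`: off the line this is
`burgersPhi_of_ne_zero`, on the line `t × (y − X₀) = 0` because `‖t × (y − X₀)‖² = r² = 0`.
[folklore] -/
theorem accretionMode_eq_burgersPhi {t : EuclideanSpace ℝ (Fin 3)} (ht : ‖t‖ = 1)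
    (X₀ y : EuclideanSpace ℝ (Fin 3)) :
    (Real.exp (-(⟪y - X₀, t⟫) ^ 2) * ((1 - Real.exp (-(‖y - X₀‖ ^ 2 - ⟪y - X₀, t⟫ ^ 2))) /
        (‖y - X₀‖ ^ 2 - ⟪y - X₀, t⟫ ^ 2))) • cross t (y - X₀) =
      (Real.exp (-(⟪y - X₀, t⟫) ^ 2) * burgersPhi (‖y - X₀‖ ^ 2 - ⟪y - X₀, t⟫ ^ 2)) •
        cross t (y - X₀) := by
  by_cases hρ : ‖y - X₀‖ ^ 2 - ⟪y - X₀, t⟫ ^ 2 = 0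
  · have hc : cross t (y - X₀) = 0 := by
      rw [← norm_cross_sq_eq_transverseRadiusSq ht, sq_eq_zero_iff, norm_eq_zero] at hρ
      exact hρ
    rw [hc, smul_zero, smul_zero]
  · rw [burgersPhi_of_ne_zero hρ]

/-- **(ii) Smoothness.** The accretion mode (in closed form) is `C^∞`: `burgersPhi` is smooth
(`contDiff_burgersPhi`), `s = ⟪y − X₀, t⟫` and `‖y − X₀‖²` are smooth, and `t × ·` is the
continuous linear map `crossCLM t`. [folklore] -/
theorem contDiff_accretionMode (t X₀ : EuclideanSpace ℝ (Fin 3)) :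
    ContDiff ℝ (⊤ : ℕ∞) (fun y : EuclideanSpace ℝ (Fin 3) =>
      (Real.exp (-(⟪y - X₀, t⟫) ^ 2) * burgersPhi (‖y - X₀‖ ^ 2 - ⟪y - X₀, t⟫ ^ 2)) •
        cross t (y - X₀)) := by
  have hv : ContDiff ℝ (⊤ : ℕ∞) (fun y : EuclideanSpace ℝ (Fin 3) => y - X₀) :=
    contDiff_id.sub contDiff_const
  have hs : ContDiff ℝ (⊤ : ℕ∞) (fun y : EuclideanSpace ℝ (Fin 3) => ⟪y - X₀, t⟫) :=
    hv.inner ℝ contDiff_const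
  have hq : ContDiff ℝ (⊤ : ℕ∞) (fun y : EuclideanSpace ℝ (Fin 3) => ‖y - X₀‖ ^ 2) := hv.norm_sq ℝ
  exact ((Real.contDiff_exp.comp (hs.pow 2).neg).mul
    (contDiff_burgersPhi.comp (hq.sub (hs.pow 2)))).smul ((crossCLM t).contDiff.comp hv)

/-- The swirl `y ↦ t × (y − X₀)` is affine with linear part `crossCLM t`. [folklore] -/
theorem hasFDerivAt_cross_sub_const (t X₀ y : EuclideanSpace ℝ (Fin 3)) :
    HasFDerivAt (fun y : EuclideanSpace ℝ (Fin 3) => cross t (y - X₀)) (crossCLM t) y := by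
  have h : (fun y : EuclideanSpace ℝ (Fin 3) => cross t (y - X₀)) =
      fun y => crossCLM t y - crossCLM t X₀ := by
    funext y; rw [← map_sub]; rfl
  rw [h]
  exact (crossCLM t).hasFDerivAt.sub_const _

/-- The swirl `y ↦ t × (y − X₀)` is divergence free: its derivative `h ↦ t × h` is skew, so its
trace `∑ᵢ ⟪eᵢ, t × eᵢ⟫` vanishes termwise. [folklore] -/
theorem divergence_cross_sub_const (t X₀ y : EuclideanSpace ℝ (Fin 3)) :
    VectorCalculus.divergence (fun y : EuclideanSpace ℝ (Fin 3) => cross t (y - X₀)) y = 0 := by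
  rw [divergence_eq_sum_inner_fderiv (EuclideanSpace.basisFun (Fin 3) ℝ),
    (hasFDerivAt_cross_sub_const t X₀ y).fderiv]
  refine Finset.sum_eq_zero fun i _ => ?_
  rw [crossCLM_apply]
  exact accretion_inner_self_cross_right _ _

/-- The scalar amplitude `φ(y) = exp(−s²) · burgersPhi (‖y − X₀‖² − s²)`, `s = ⟪y − X₀, t⟫`, has
zero derivative along the swirl direction `t × (y − X₀)`: `φ` factors through
`y ↦ (s, ‖y − X₀‖²)`, whose derivative `h ↦ (⟪h, t⟫, 2⟪y − X₀, h⟫)` kills `t × (y − X₀)`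
(`⟪t × v, t⟫ = 0`, `⟪v, t × v⟫ = 0`). [folklore] -/
theorem fderiv_accretionAmplitude_cross (t X₀ y : EuclideanSpace ℝ (Fin 3)) :
    fderiv ℝ (fun y : EuclideanSpace ℝ (Fin 3) =>
      Real.exp (-(⟪y - X₀, t⟫) ^ 2) * burgersPhi (‖y - X₀‖ ^ 2 - ⟪y - X₀, t⟫ ^ 2)) y
        (cross t (y - X₀)) = 0 := by
  set F : ℝ × ℝ → ℝ := fun p => Real.exp (-(p.1) ^ 2) * burgersPhi (p.2 - p.1 ^ 2) with hF
  have hFd : Differentiable ℝ F :=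
    (Real.differentiable_exp.comp (differentiable_fst.pow 2).neg).mul
      (((contDiff_burgersPhi (n := 1)).differentiable one_ne_zero).comp
        (differentiable_snd.sub (differentiable_fst.pow 2)))
  have hv : HasFDerivAt (fun y : EuclideanSpace ℝ (Fin 3) => y - X₀)
      (ContinuousLinearMap.id ℝ (EuclideanSpace ℝ (Fin 3))) y :=
    (hasFDerivAt_id y).sub_const X₀
  obtain ⟨ψ', hψ, h0⟩ : ∃ ψ' : EuclideanSpace ℝ (Fin 3) →L[ℝ] ℝ × ℝ,
      HasFDerivAt (fun y : EuclideanSpace ℝ (Fin 3) => (⟪y - X₀, t⟫, ‖y - X₀‖ ^ 2)) ψ' y ∧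
        ψ' (cross t (y - X₀)) = 0 :=
    ⟨_, (hv.inner ℝ (hasFDerivAt_const t y)).prodMk hv.norm_sq, by
      simp only [ContinuousLinearMap.prod_apply, Prod.mk_eq_zero, ContinuousLinearMap.coe_comp,
        Function.comp_apply, fderivInnerCLM_apply, ContinuousLinearMap.coe_id', id_eq,
        zero_apply, inner_zero_right, add_zero, FunLike.coe_smul,
        Pi.smul_apply, innerSL_apply_apply, accretion_inner_cross_self_left,
        accretion_inner_self_cross_right, smul_zero, and_self]⟩
  have hφ : HasFDerivAt (fun y : EuclideanSpace ℝ (Fin 3) =>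
      Real.exp (-(⟪y - X₀, t⟫) ^ 2) * burgersPhi (‖y - X₀‖ ^ 2 - ⟪y - X₀, t⟫ ^ 2))
      ((fderiv ℝ F (⟪y - X₀, t⟫, ‖y - X₀‖ ^ 2)).comp ψ') y :=
    (hFd _).hasFDerivAt.comp y hψ
  rw [hφ.fderiv, ContinuousLinearMap.comp_apply, h0, map_zero]

/-- **(iii) Divergence free.** `div (φ L) = φ div L + ⟪L, ∇φ⟫ = φ · 0 + Dφ (t × (y − X₀)) = 0`
(`divergence_smul_apply`, `divergence_cross_sub_const`, `fderiv_accretionAmplitude_cross`).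
[folklore] -/
theorem isDivFree_accretionMode (t X₀ : EuclideanSpace ℝ (Fin 3)) :
    VectorCalculus.IsDivFree (fun y : EuclideanSpace ℝ (Fin 3) =>
      (Real.exp (-(⟪y - X₀, t⟫) ^ 2) * burgersPhi (‖y - X₀‖ ^ 2 - ⟪y - X₀, t⟫ ^ 2)) •
        cross t (y - X₀)) := by
  intro y
  have hθ : Differentiable ℝ (fun y : EuclideanSpace ℝ (Fin 3) =>
      Real.exp (-(⟪y - X₀, t⟫) ^ 2) * burgersPhi (‖y - X₀‖ ^ 2 - ⟪y - X₀, t⟫ ^ 2)) := by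
    have hv : Differentiable ℝ (fun y : EuclideanSpace ℝ (Fin 3) => y - X₀) :=
      differentiable_id.sub_const X₀
    have hs : Differentiable ℝ (fun y : EuclideanSpace ℝ (Fin 3) => ⟪y - X₀, t⟫) :=
      hv.inner ℝ (differentiable_const t)
    have hq : Differentiable ℝ (fun y : EuclideanSpace ℝ (Fin 3) => ‖y - X₀‖ ^ 2) := hv.norm_sq ℝ
    exact (Real.differentiable_exp.comp (hs.pow 2).neg).mul
      (((contDiff_burgersPhi (n := 1)).differentiable one_ne_zero).comp (hq.sub (hs.pow 2)))
  rw [divergence_smul_apply (hθ y) (hasFDerivAt_cross_sub_const t X₀ y).differentiableAt,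
    divergence_cross_sub_const, mul_zero, zero_add, real_inner_comm, gradient,
    InnerProductSpace.toDual_symm_apply]
  exact fderiv_accretionAmplitude_cross t X₀ y

/-- **(iv) Unit bound.** `‖D y‖ ≤ 1`: with `ρ = r² = ‖t × (y − X₀)‖²`, either `ρ = 0` (then
`t × (y − X₀) = 0`) or `‖D y‖ = exp(−s²) · (1 − e^{−ρ})/ρ · √ρ ≤ (1 − e^{−ρ})/√ρ ≤ 1`, using
`1 − e^{−ρ} ≤ min(ρ, 1) ≤ √ρ`. [folklore] -/
theorem norm_accretionMode_le_one {t : EuclideanSpace ℝ (Fin 3)} (ht : ‖t‖ = 1)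
    (X₀ y : EuclideanSpace ℝ (Fin 3)) :
    ‖(Real.exp (-(⟪y - X₀, t⟫) ^ 2) * burgersPhi (‖y - X₀‖ ^ 2 - ⟪y - X₀, t⟫ ^ 2)) •
        cross t (y - X₀)‖ ≤ 1 := by
  have hρ := norm_cross_sq_eq_transverseRadiusSq ht (y - X₀)
  set ρ := ‖y - X₀‖ ^ 2 - ⟪y - X₀, t⟫ ^ 2 with hρdef
  have hρ0 : 0 ≤ ρ := hρ ▸ sq_nonneg _
  rw [norm_smul, Real.norm_eq_abs,
    abs_of_nonneg (mul_nonneg (Real.exp_pos _).le (burgersPhi_pos _).le)]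
  rcases hρ0.eq_or_lt with h0 | hpos
  · have hc : cross t (y - X₀) = 0 := by
      rw [← h0, sq_eq_zero_iff, norm_eq_zero] at hρ
      exact hρ
    rw [hc, norm_zero, mul_zero]
    exact zero_le_one
  · have hcross : ‖cross t (y - X₀)‖ = Real.sqrt ρ := by
      rw [← hρ, Real.sqrt_sq (norm_nonneg _)]
    rw [hcross, burgersPhi_of_ne_zero hpos.ne']
    have h1 : Real.exp (-(⟪y - X₀, t⟫) ^ 2) ≤ 1 :=
      Real.exp_le_one_iff.mpr (neg_nonpos.mpr (sq_nonneg _))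
    have h3 : 0 ≤ 1 - Real.exp (-ρ) := by
      have := Real.exp_le_one_iff.mpr (neg_nonpos.mpr hρ0)
      linarith
    have h2 : 1 - Real.exp (-ρ) ≤ Real.sqrt ρ := by
      apply Real.le_sqrt_of_sq_le
      have h4 : 1 - Real.exp (-ρ) ≤ ρ := by linarith [Real.add_one_le_exp (-ρ)]
      have h5 : 1 - Real.exp (-ρ) ≤ 1 := by linarith [Real.exp_pos (-ρ)]
      nlinarith
    calc Real.exp (-(⟪y - X₀, t⟫) ^ 2) * ((1 - Real.exp (-ρ)) / ρ) * Real.sqrt ρ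
        ≤ 1 * ((1 - Real.exp (-ρ)) / ρ) * Real.sqrt ρ := by gcongr
      _ = (1 - Real.exp (-ρ)) * Real.sqrt ρ / ρ := by ring
      _ ≤ Real.sqrt ρ * Real.sqrt ρ / ρ := by gcongr
      _ = 1 := by rw [Real.mul_self_sqrt hρ0, div_self hpos.ne']

/-- Registered tools stub of crux stmt-NavierStokesRegularity-15401, line `zero-accretion-selection`
(`stub_accretionModeTools`): for a unit tangent `t`, a base point `X₀` and the accretion mode `D`
given by the junk-valued formula, (i) `D` equals the smooth `burgersPhi` closed form, (ii) `D` is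
`C^∞`, (iii) `div D = 0`, (iv) `‖D y‖ ≤ 1`. [folklore] -/
theorem stub_accretionModeTools : ∀ (t X₀ : EuclideanSpace ℝ (Fin 3))
    (D : EuclideanSpace ℝ (Fin 3) → EuclideanSpace ℝ (Fin 3)), ‖t‖ = 1 →
    (∀ y, D y = (Real.exp (-(inner ℝ (y - X₀) t) ^ 2) *
      ((1 - Real.exp (-(‖y - X₀‖ ^ 2 - inner ℝ (y - X₀) t ^ 2))) /
        (‖y - X₀‖ ^ 2 - inner ℝ (y - X₀) t ^ 2))) • Literature.Analysis.FluidPDE.cross t (y - X₀)) →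
    (∀ y, D y = (Real.exp (-(inner ℝ (y - X₀) t) ^ 2) *
      Literature.Analysis.FluidPDE.burgersPhi (‖y - X₀‖ ^ 2 - inner ℝ (y - X₀) t ^ 2)) •
        Literature.Analysis.FluidPDE.cross t (y - X₀)) ∧ ContDiff ℝ (⊤ : ℕ∞) D ∧
    Literature.Analysis.FluidPDE.VectorCalculus.IsDivFree D ∧ (∀ y, ‖D y‖ ≤ 1) := by
  intro t X₀ D ht hD
  have hD' : ∀ y, D y = (Real.exp (-(⟪y - X₀, t⟫) ^ 2) *
      burgersPhi (‖y - X₀‖ ^ 2 - ⟪y - X₀, t⟫ ^ 2)) • cross t (y - X₀) := fun y =>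
    (hD y).trans (accretionMode_eq_burgersPhi ht X₀ y)
  have hDf : D = fun y => (Real.exp (-(⟪y - X₀, t⟫) ^ 2) *
      burgersPhi (‖y - X₀‖ ^ 2 - ⟪y - X₀, t⟫ ^ 2)) • cross t (y - X₀) := funext hD'
  refine ⟨hD', ?_, ?_, fun y => ?_⟩
  · rw [hDf]; exact contDiff_accretionMode t X₀
  · rw [hDf]; exact isDivFree_accretionMode t X₀
  · rw [hD' y]; exact norm_accretionMode_le_one ht X₀ y

end Summit.NavierStokesRegularity.NavierStokesRegularity.Theorems
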